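import Literature.AlgebraicGeometry.Deligne1982.WeilTypeCMHodgeGroupSUCentre
import Literature.AlgebraicGeometry.VanGeemen1994.WeilTypeHodgeGroupSUEndomorphismField
import Literature.AlgebraicGeometry.HodgeTheory.NoTypeIVFactorCentralPullbacks
import Mathlib.LinearAlgebra.Lagrange
import HarnessLib

/-!
# The general member of a CM-Weil family: `End⁰(A) = E` — the commutant of `SU(φ)(ℂ)` on `H¹` is `ℂ[η^*]`,
# `[End⁰(A) : ℚ] = [E : ℚ] = 2e₀`, `End⁰(A) = ℚ(η)` is a field, so `A` is SIMPLE, of TYPE IV, NOT of CM type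
# (Deligne 1982 §4 with Milne's endnote 16; Milne 2025 Ex. 1.17; van Geemen LNM 1594, 6.9–6.11 for `E` quadratic)

Family `hodge`, layer `Literature/AlgebraicGeometry/Deligne1982`; THEOREMS ONLY — no definition, no named fact, no
`sorry` (D-0026, net debt 0). Lane `lit-hodgefound` (Track 2 foundations library), prover seat `lit-hodgefound-p21`,
generation 31, row g31-#9: the CM-field analogue of the seat's g30-#4 (`WeilTypeHodgeGroupSUEndomorphismsCommute`) and
g30-#6 (`WeilTypeHodgeGroupSUEndomorphismField`), built on the tree's block tori and signed block transpositions of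
`SU(φ)(ℂ)` (`WeilTypeCMHodgeGroupSUCentre`: `torusCM`, `swapCM`) and its Weil basis `weilBasisι` (`WeilTypeCMHodgeRingHolds`).

PUBLISHED STATEMENTS (held `paper:arxiv-2508.09972`, `book:green1994-algebraic-cycles-hodge-theory-lectures-given-at`,
re-read this session). J. S. Milne, arXiv:2508.09972, §1.5 Example 1.17 (chunk p0006 L122–L149): for a CM field `Q` and
«`(A, ν, λ)` general», an exact commutative diagram with `MT(A) ↪ L(A)`, `SU(φ) ↪ GU(φ)`, and `L(A) = GU(φ)` — the
Lefschetz group of `A` (the centraliser of `End⁰(A)` in the symplectic similitudes) is the full unitary similitude group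
of `φ`, i.e. `C(A) = End⁰(A) = Q`. P. Deligne, LNM 900 (1982), §4 (4.4)–(4.8) with Milne's endnote 16: the special
Mumford–Tate group of the general `(A, E, λ)` is `SU(φ)`. B. van Geemen, LNM 1594 (p0229–p0231), 6.9: «`SU_H` will be the
Special Mumford Tate group of a general abelian variety of Weil-type»; Lemma 6.10 (`V_ℂ = W ⊕ W^*`, `SU_H(ℂ) ≅ SL(2n, ℂ)`,
«the same argument works in general»); with 6.4–6.5 and Deligne I 3.4–3.5 the endomorphisms of `A` are the
`ℚ`-endomorphisms of `H¹` commuting with the Hodge group, so «`End⁰(X) = K`» for the general member. B. Moonen,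
Yu. G. Zarhin, Math. Ann. 315 (1999) §1: Albert type IV(`e₀`, `d`) — here `End⁰(A) = E`, `d = 1`.

MECHANISM (`SU(φ)(ℂ) ≅ ∏_{τ ∈ Φ} SL(W_τ)` acting on `H¹(A(ℂ); ℂ) = ⊕_τ W_τ ⊕ W'_τ`, `W_τ = ker(η^* - τ)`,
`W'_τ = ker(η^* + τ) ≅ W_τ^*`, all of dimension `2k`; Schur: for `2k ≥ 3` the `4e₀`… `2e₀` summands are irreducible and
pairwise non-isomorphic, so `End(H¹)^{SU(φ)(ℂ)} = ⊕_τ (ℂ ⊕ ℂ) = E ⊗ ℂ`). On the carriers: an operator `x` commuting with the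
block tori `diag(…, 2, …, ½, …)` of `SL(W_β)` (and their contragredients on `W'_β`) has no matrix coefficient between two
Weil-basis lines separated by some torus — for `2k ≥ 3` every pair of distinct lines is separated
(`repr_weilBasisι_apply_eq_zero_of_commute`); commuting with the signed transpositions makes the diagonal constant on
each `W_β` and each `W'_β` (`exists_apply_wBasisCM_eq_smul_of_commute`); interpolating the `2e₀` scalars at the simple
eigenvalues `±τ_β` of `η^*` writes `x` as a polynomial in `η^*` (`exists_eq_aeval_pullbackOne_of_commute`).

WHAT IS PROVED (`hW : IsWeilTypeCM A η R e₀ k`, `hpol : IsPolarizationClass A.dim A.X h`, `hRos : IsRosatiCM A η h`,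
`hSU : HasHodgeGroupSUCM A η (R(T²)) h`, and `2 ≤ k`):
* §1–§2 the commutant: `exists_apply_wBasisCM_eq_smul_of_commute`, **`exists_eq_aeval_pullbackOne_of_commute`**,
  `mem_span_pow_pullbackOne_of_commute` (`x ∈ ⟨1, η^*, …, (η^*)^{2e₀-1}⟩_ℂ`); for endomorphisms of `A`:
  **`exists_pullbackOne_eq_aeval_of_hasHodgeGroupSUCM`** (`ψ^* = Q(η^*)`), `pullbackOne_mem_span_pow_of_hasHodgeGroupSUCM`,
  `comp_comm_of_hasHodgeGroupSUCM` (`End(A)` is commutative), `comp_eta_comm_of_hasHodgeGroupSUCM` (`η` is central).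
* §3 **`finrank_endAlgebra_le_of_hasHodgeGroupSUCM`** (`[End⁰(A) : ℚ] ≤ 2e₀`), `minpoly_endAlgebra_of_eta`
  (`minpoly_ℚ(1 ⊗ η) = P_R`), `linearIndependent_pow_endAlgebra_of_eta`, **`finrank_endAlgebra_eq_of_hasHodgeGroupSUCM`**
  (`= 2e₀ = [E : ℚ]`), `exists_eq_aeval_endAlgebra_of_hasHodgeGroupSUCM` (`End⁰(A) = ℚ[η]`),
  `endAlgebra_mul_comm_of_hasHodgeGroupSUCM`.
* §4 **`isField_endAlgebra_of_hasHodgeGroupSUCM`** (`End⁰(A) = ℚ(η) ≅ E`), **`isSimple_of_hasHodgeGroupSUCM`**,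
  **`not_hasNoTypeIVFactor_of_hasHodgeGroupSUCM`** (type IV: the central `η` has the non-real eigenvalue `τ_β`),
  `isCMField_endField_of_hasHodgeGroupSUCM`, **`not_isOfCMType_of_hasHodgeGroupSUCM`** (`2e₀ < 2 dim A = 4ke₀`), and the
  summary `weilTypeCM_generalMember_summary`.

HONESTY CLAUSE. `HasHodgeGroupSUCM` (endnote 16's «general») is a hypothesis; `k = 1` is excluded (there `W ≅ W^*` as
`SL₂`-modules and `End⁰(A)` can be a quaternion algebra); no isomorphism `End⁰(A) ≃ E = ℚ[T]/(P_R)` of `ℚ`-algebras is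
constructed — what is proved is `End⁰(A) = ℚ[1 ⊗ η]` with `minpoly(1 ⊗ η) = P_R`, a field of degree `2e₀`.

## References

* [Milne2025AbelianMotivesCharP] J. S. Milne, Abelian motives and Shimura varieties in nonzero characteristic,
  arXiv:2508.09972, §1.5 Example 1.17. [cite: Milne2025AbelianMotivesCharP, §1.5 Example 1.17]
* [Deligne1982HodgeCycles] P. Deligne, Hodge cycles on abelian varieties, LNM 900 (1982), §4 (4.4)–(4.8), I Prop. 3.4–3.5;
  J. S. Milne's endnote 16 (2003). [cite: Deligne1982HodgeCycles, §4 (4.4) and Milne 2003 re-edition endnote 16]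
* [vanGeemen1994HodgeAV] B. van Geemen, LNM 1594 (1994), 6.4–6.5, 6.9, Lemma 6.10, Thm. 6.11.
  [cite: vanGeemen1994HodgeAV, 6.9, Lemma 6.10 and Thm. 6.11]
* [MoonenZarhin1999LowDim] B. Moonen, Yu. G. Zarhin, Math. Ann. 315 (1999), §1 (Albert types). [cite: MoonenZarhin1999LowDim, §1]
* [LangeBirkenhake1992] H. Lange, Ch. Birkenhake, Complex Abelian Varieties, §1.2 Prop. 1.2.3. [cite: LangeBirkenhake1992, §1.2 Prop. 1.2.3]
-/

noncomputable section

open CategoryTheory Polynomial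
open scoped TensorProduct
open Literature.AlgebraicTopology.SingularHomology
open Literature.AlgebraicGeometry.Motives
open Literature.AlgebraicGeometry.HodgeTheory
open Literature.AlgebraicGeometry.VanGeemen1994
open Literature.AlgebraicGeometry.ComplexMultiplication

namespace Literature.AlgebraicGeometry.Deligne1982

/-! ### §0 Two lemmas of linear algebra: operators commuting with (monomial) diagonal operators -/

section LinearAlgebra

variable {ι V : Type*} [AddCommGroup V] [Module ℂ V]

/-- If `x` commutes with an operator `D` diagonal in the basis `b` (`D bᵢ = cᵢ bᵢ`), then `x` has no matrix coefficient
between two basis vectors with different `D`-weights: `(x bᵢ)_j = 0` for `cᵢ ≠ c_j`. [folklore] -/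
private theorem repr_apply_eq_zero_of_comm (b : Module.Basis ι ℂ V) {D x : V →ₗ[ℂ] V} {c : ι → ℂ}
    (hD : ∀ i, D (b i) = c i • b i) (hx : ∀ v, x (D v) = D (x v)) {i j : ι} (hij : c i ≠ c j) :
    b.repr (x (b i)) j = 0 := by
  classical
  have key : ∀ v, b.repr (D v) j = c j * b.repr v j := by
    intro v
    have hfun : (b.coord j) ∘ₗ D = c j • b.coord j := by
      refine b.ext fun i' ↦ ?_
      simp only [LinearMap.comp_apply, Module.Basis.coord_apply, hD, map_smul, Module.Basis.repr_self,
        LinearMap.smul_apply, smul_eq_mul, Finsupp.single_apply]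
      split_ifs with h
      · subst h; rfl
      · rw [mul_zero, mul_zero]
    simpa only [LinearMap.comp_apply, Module.Basis.coord_apply, LinearMap.smul_apply, smul_eq_mul] using
      LinearMap.congr_fun hfun v
  have e := congrArg (fun v ↦ b.repr v j) (hx (b i))
  simp only [hD, map_smul, Finsupp.smul_apply, smul_eq_mul] at e
  rw [key] at e
  exact (mul_eq_mul_right_iff.1 e).resolve_left hij

/-- If `x` is diagonal in the basis `b` (`x bᵢ = aᵢ bᵢ`) and commutes with a monomial operator `M bᵢ = cᵢ b_{π i}`
(`cᵢ ≠ 0`), then `a_{π i} = aᵢ`. [folklore] -/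
private theorem diag_eq_of_comm (b : Module.Basis ι ℂ V) {a : ι → ℂ} {x M : V →ₗ[ℂ] V} (ha : ∀ i, x (b i) = a i • b i)
    {π : ι → ι} {c : ι → ℂ} (hM : ∀ i, M (b i) = c i • b (π i)) (hc : ∀ i, c i ≠ 0)
    (hx : ∀ v, x (M v) = M (x v)) (i : ι) : a (π i) = a i := by
  have e := hx (b i)
  rw [hM i, map_smul, ha (π i), ha i, map_smul, hM i, smul_smul, smul_smul] at e
  have e' : c i * a (π i) = a i * c i := smul_left_injective ℂ (b.ne_zero (π i)) e
  rw [mul_comm (a i)] at e'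
  exact mul_left_cancel₀ (hc i) e'

end LinearAlgebra

variable {A : AbelianVariety ℂ} {η : A ⟶ A} {R : Polynomial ℤ} {e₀ k : ℕ} {h : complexBetti A.X 2}

/-! ### §1 The commutant of `SU(φ)(ℂ)` on `H¹(A(ℂ); ℂ)` is diagonal on the Weil basis, with one scalar per block -/

section Commutant

variable (hW : IsWeilTypeCM A η R e₀ k) (hpol : IsPolarizationClass A.dim A.X h) (hRos : IsRosatiCM A η h)

/-- `monoAutoCM π c (b_p) = c_{π p} • b_{π p}` on the Weil basis `b = weilBasisι` (re-derived; the tree's copy is private).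
[cite: vanGeemen1994HodgeAV, Lemma 6.10] -/
private theorem monoAutoCM_weilBasisι' (π : Equiv.Perm (Fin (cmDeg R) × (Fin (2 * k) × Fin 2)))
    (c : Fin (cmDeg R) × (Fin (2 * k) × Fin 2) → ℂˣ) (p : Fin (cmDeg R) × (Fin (2 * k) × Fin 2)) :
    monoAutoCM hW hpol hRos π c (weilBasisι hW hpol hRos p) = (c (π p) : ℂ) • weilBasisι hW hpol hRos (π p) := by
  rw [monoAutoCM, Module.Basis.equiv_apply, Module.Basis.unitsSMul_apply, Units.smul_def]

omit hW hpol hRos in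
/-- `blockPermCM β σ (β', i, s) = (β', σ i, s)` if `β' = β`, else `(β', i, s)` (re-derived). [folklore] -/
private theorem blockPermCM_apply' (β : Fin (cmDeg R)) (σ : Equiv.Perm (Fin (2 * k)))
    (p : Fin (cmDeg R) × (Fin (2 * k) × Fin 2)) :
    blockPermCM β σ p = (p.1, (if p.1 = β then σ p.2.1 else p.2.1), p.2.2) := by
  obtain ⟨β', i, s⟩ := p
  rw [blockPermCM, Equiv.prodCongrRight_apply]
  by_cases hb : β' = β
  · simp [hb]
  · simp [hb]

/-- The block torus on the Weil basis: `torusCM β i₀ i₁ (b_p) = t_p • b_p`, `t = torusUnitsCM β i₀ i₁`.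
[cite: vanGeemen1994HodgeAV, Lemma 6.10] -/
private theorem torusCM_weilBasisι' (β : Fin (cmDeg R)) (i₀ i₁ : Fin (2 * k)) (p : Fin (cmDeg R) × (Fin (2 * k) × Fin 2)) :
    torusCM hW hpol hRos β i₀ i₁ (weilBasisι hW hpol hRos p) = (torusUnitsCM β i₀ i₁ p : ℂ) • weilBasisι hW hpol hRos p := by
  have h1 : blockPermCM β (1 : Equiv.Perm (Fin (2 * k))) p = p := by
    rw [blockPermCM_apply']
    obtain ⟨β', i, s⟩ := p
    simp
  rw [torusCM, monoAutoCM_weilBasisι', h1]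

/-- The signed block transposition on the Weil basis: `swapCM β x y (b_p) = ε • b_{(x y) p}`.
[cite: vanGeemen1994HodgeAV, Lemma 6.10] -/
private theorem swapCM_weilBasisι' (β : Fin (cmDeg R)) (x y : Fin (2 * k)) (p : Fin (cmDeg R) × (Fin (2 * k) × Fin 2)) :
    swapCM hW hpol hRos β x y (weilBasisι hW hpol hRos p) =
      (swapUnitsCM β x (blockPermCM β (Equiv.swap x y) p) : ℂ) • weilBasisι hW hpol hRos (blockPermCM β (Equiv.swap x y) p) := by
  rw [swapCM, monoAutoCM_weilBasisι']

omit hW hpol hRos in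
/-- Torus weights: `t_{i₀} = 2` (as a unit) for `i₀ ≠ i₁`. [folklore] -/
private theorem torusWtCM_self' {K : ℕ} {i₀ i₁ : Fin K} (hne : i₀ ≠ i₁) : torusWtCM i₀ i₁ i₀ = twoU := by
  rw [torusWtCM, Function.update_of_ne hne, Function.update_self]

omit hW hpol hRos in
/-- Torus weights: `t_j = 1` for `j ∉ {i₀, i₁}`. [folklore] -/
private theorem torusWtCM_other' {K : ℕ} {i₀ i₁ j : Fin K} (h₀ : j ≠ i₀) (h₁ : j ≠ i₁) : torusWtCM i₀ i₁ j = 1 := by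
  rw [torusWtCM, Function.update_of_ne h₁, Function.update_of_ne h₀]

omit hW hpol hRos in
/-- `(2 : ℂˣ) = 2` in `ℂ`. [folklore] -/
private theorem coe_twoU' : ((twoU : ℂˣ) : ℂ) = 2 := rfl

omit hW hpol hRos in
/-- `(2⁻¹ : ℂˣ) = 2⁻¹` in `ℂ`. [folklore] -/
private theorem coe_twoU_inv' : ((twoU⁻¹ : ℂˣ) : ℂ) = 2⁻¹ := by
  rw [Units.val_inv_eq_inv_val]; rfl

omit hW hpol hRos in
/-- In `Fin (2k)` with `k ≥ 2` there is an index off any two given ones. [folklore] -/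
private theorem exists_ne_ne' (hk : 2 ≤ k) (i j : Fin (2 * k)) : ∃ q : Fin (2 * k), q ≠ i ∧ q ≠ j := by
  classical
  by_contra hcon
  push Not at hcon
  have hsub : (Finset.univ : Finset (Fin (2 * k))) ⊆ {i, j} := fun q _ ↦ by
    rw [Finset.mem_insert, Finset.mem_singleton]
    by_cases hq : q = i
    · exact Or.inl hq
    · exact Or.inr (hcon q hq)
  have hcard := Finset.card_le_card hsub
  rw [Finset.card_univ, Fintype.card_fin] at hcard
  have h2 := Finset.card_le_two (a := i) (b := j)
  omega

omit hW hpol hRos in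
/-- **Separation**: for `2k ≥ 3`, any two distinct Weil-basis lines `b_{r₀} ≠ b_r` are separated by a block torus of the
block of `r₀` through `r₀`'s index and an index `q` off both: the weights at `r₀` (`2` or `½`) and at `r` differ.
[cite: vanGeemen1994HodgeAV, Lemma 6.10 (the diagonal torus of `SL(W)`)] -/
private theorem exists_torus_separating (hk : 2 ≤ k) (r₀ r : Fin (cmDeg R) × (Fin (2 * k) × Fin 2)) (hr : r ≠ r₀) :
    ∃ q : Fin (2 * k), q ≠ r₀.2.1 ∧
      (torusUnitsCM r₀.1 r₀.2.1 q r₀ : ℂ) ≠ (torusUnitsCM r₀.1 r₀.2.1 q r : ℂ) := by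
  obtain ⟨β, i, s⟩ := r₀
  obtain ⟨γ, j, s'⟩ := r
  obtain ⟨q, hqi, hqj⟩ := exists_ne_ne' hk i j
  refine ⟨q, hqi, ?_⟩
  have hti : torusWtCM i q i = twoU := torusWtCM_self' (Ne.symm hqi)
  -- the weight at `r₀ = (β, i, s)` is `2` or `½`
  have h0 : (torusUnitsCM β i q (β, i, s) : ℂ) = if s = 0 then 2 else 2⁻¹ := by
    unfold torusUnitsCM
    simp only [if_true, hti]
    split_ifs
    · exact coe_twoU'
    · exact coe_twoU_inv'
  simp only
  rw [h0]
  by_cases hγ : γ = β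
  · subst hγ
    by_cases hj : j = i
    · subst hj
      -- same line up to the side `s ≠ s'`
      have hs : s' ≠ s := fun e ↦ hr (by rw [e])
      have h1 : (torusUnitsCM γ j q (γ, j, s') : ℂ) = if s' = 0 then 2 else 2⁻¹ := by
        unfold torusUnitsCM
        simp only [if_true, hti]
        split_ifs
        · exact coe_twoU'
        · exact coe_twoU_inv'
      rw [h1]
      fin_cases s <;> fin_cases s' <;> simp at hs ⊢ <;> norm_num
    · have htj : torusWtCM i q j = 1 := torusWtCM_other' hj (Ne.symm hqj)
      have h1 : (torusUnitsCM γ i q (γ, j, s') : ℂ) = 1 := by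
        unfold torusUnitsCM
        simp only [if_true, htj, inv_one]
        split_ifs <;> rfl
      rw [h1]
      split_ifs <;> norm_num
  · have h1 : (torusUnitsCM β i q (γ, j, s') : ℂ) = 1 := by
      unfold torusUnitsCM
      simp [hγ]
    rw [h1]
    split_ifs <;> norm_num

/-- **An operator commuting with the block tori of `SU(φ)(ℂ)` is diagonal on the Weil basis** (`2k ≥ 3`).
[cite: vanGeemen1994HodgeAV, Lemma 6.10] [cite: Deligne1982HodgeCycles, Milne 2003 re-edition endnote 16] -/
theorem repr_weilBasisι_apply_eq_zero_of_commute (hk : 2 ≤ k) {x : complexBetti A.X 1 →ₗ[ℂ] complexBetti A.X 1}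
    (hx : ∀ (β : Fin (cmDeg R)) (p q : Fin (2 * k)), p ≠ q →
      ∀ v, x (torusCM hW hpol hRos β p q v) = torusCM hW hpol hRos β p q (x v))
    {r₀ r : Fin (cmDeg R) × (Fin (2 * k) × Fin 2)} (hr : r ≠ r₀) :
    (weilBasisι hW hpol hRos).repr (x (weilBasisι hW hpol hRos r₀)) r = 0 := by
  obtain ⟨q, hq, hne⟩ := exists_torus_separating hk r₀ r hr
  exact repr_apply_eq_zero_of_comm (weilBasisι hW hpol hRos)
    (D := ((torusCM hW hpol hRos r₀.1 r₀.2.1 q : complexBetti A.X 1 ≃ₗ[ℂ] complexBetti A.X 1) :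
      complexBetti A.X 1 →ₗ[ℂ] complexBetti A.X 1))
    (c := fun p ↦ (torusUnitsCM r₀.1 r₀.2.1 q p : ℂ))
    (fun p ↦ by rw [LinearEquiv.coe_coe]; exact torusCM_weilBasisι' hW hpol hRos _ _ _ p)
    (hx r₀.1 r₀.2.1 q (Ne.symm hq)) hne

/-- The diagonal form: `x (b_r) = (x b_r)_r • b_r`. [cite: vanGeemen1994HodgeAV, Lemma 6.10] -/
theorem apply_weilBasisι_eq_smul_of_commute (hk : 2 ≤ k) {x : complexBetti A.X 1 →ₗ[ℂ] complexBetti A.X 1}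
    (hx : ∀ (β : Fin (cmDeg R)) (p q : Fin (2 * k)), p ≠ q →
      ∀ v, x (torusCM hW hpol hRos β p q v) = torusCM hW hpol hRos β p q (x v))
    (r : Fin (cmDeg R) × (Fin (2 * k) × Fin 2)) :
    x (weilBasisι hW hpol hRos r) =
      (weilBasisι hW hpol hRos).repr (x (weilBasisι hW hpol hRos r)) r • weilBasisι hW hpol hRos r := by
  classical
  conv_lhs => rw [← (weilBasisι hW hpol hRos).sum_repr (x (weilBasisι hW hpol hRos r))]
  rw [Finset.sum_eq_single r (fun r' _ hr' ↦ by
    rw [repr_weilBasisι_apply_eq_zero_of_commute hW hpol hRos hk hx hr', zero_smul])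
    (fun hnot ↦ absurd (Finset.mem_univ r) hnot)]

/-- **Within a block the diagonal is constant**: commuting also with the signed transpositions `(p q)` of `W_β`, `W'_β`
forces `(x b_{(β,q,s)})_{(β,q,s)} = (x b_{(β,p,s)})_{(β,p,s)}`. [cite: vanGeemen1994HodgeAV, Lemma 6.10] -/
theorem repr_diag_eq_of_commute (hk : 2 ≤ k) {x : complexBetti A.X 1 →ₗ[ℂ] complexBetti A.X 1}
    (hx : ∀ (β : Fin (cmDeg R)) (p q : Fin (2 * k)), p ≠ q →
      ∀ v, x (torusCM hW hpol hRos β p q v) = torusCM hW hpol hRos β p q (x v))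
    (hx' : ∀ (β : Fin (cmDeg R)) (p q : Fin (2 * k)), p ≠ q →
      ∀ v, x (swapCM hW hpol hRos β p q v) = swapCM hW hpol hRos β p q (x v))
    (β : Fin (cmDeg R)) {p q : Fin (2 * k)} (hpq : p ≠ q) (s : Fin 2) :
    (weilBasisι hW hpol hRos).repr (x (weilBasisι hW hpol hRos (β, q, s))) (β, q, s) =
      (weilBasisι hW hpol hRos).repr (x (weilBasisι hW hpol hRos (β, p, s))) (β, p, s) := by
  have h := diag_eq_of_comm (weilBasisι hW hpol hRos)
    (a := fun r ↦ (weilBasisι hW hpol hRos).repr (x (weilBasisι hW hpol hRos r)) r)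
    (M := ((swapCM hW hpol hRos β p q : complexBetti A.X 1 ≃ₗ[ℂ] complexBetti A.X 1) :
      complexBetti A.X 1 →ₗ[ℂ] complexBetti A.X 1))
    (apply_weilBasisι_eq_smul_of_commute hW hpol hRos hk hx)
    (π := blockPermCM β (Equiv.swap p q))
    (c := fun r ↦ (swapUnitsCM β p (blockPermCM β (Equiv.swap p q) r) : ℂ))
    (fun r ↦ by rw [LinearEquiv.coe_coe]; exact swapCM_weilBasisι' hW hpol hRos β p q r)
    (fun r ↦ Units.ne_zero _) (hx' β p q hpq) (β, p, s)
  have hπ : blockPermCM β (Equiv.swap p q) (β, p, s) = (β, q, s) := by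
    rw [blockPermCM_apply']
    simp
  simpa only [hπ] using h

/-- `b_{(β, i, 0)} = w^β_i` (re-derived). [folklore] -/
private theorem weilBasisι_zero' (β : Fin (cmDeg R)) (i : Fin (2 * k)) :
    weilBasisι hW hpol hRos (β, i, 0) = (wBasisCM hW β i : complexBetti A.X 1) := by
  rw [weilBasisι, Module.Basis.mk_apply]
  simp [weilVec]

/-- `b_{(β, i, 1)} = w*^β_i` (re-derived). [folklore] -/
private theorem weilBasisι_one' (β : Fin (cmDeg R)) (i : Fin (2 * k)) :
    weilBasisι hW hpol hRos (β, i, 1) = (wDualBasisCM hW hpol hRos β i : complexBetti A.X 1) := by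
  rw [weilBasisι, Module.Basis.mk_apply]
  simp [weilVec]

/-- **The commutant of `SU(φ)(ℂ)` on `H¹(A(ℂ); ℂ)`, `2k ≥ 4`: one scalar per block.** An operator `x` commuting with
every element of `SU(φ)(ℂ) = weilSpecialUnitaryGroupCM A η (R(T²)) h` acts on the Weil basis by `x w^β_i = t_β w^β_i`,
`x w*^β_j = s_β w*^β_j` — «`End_ℂ(V_ℂ)^{SL(W)} = ℂ·1_W ⊕ ℂ·1_{W^*}`», embedding by embedding («the same argument works in
general»). [cite: vanGeemen1994HodgeAV, Lemma 6.10 and 6.9] [cite: Deligne1982HodgeCycles, §4 p. 32 and Milne 2003 re-edition endnote 16] -/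
theorem exists_apply_wBasisCM_eq_smul_of_commute (hk : 2 ≤ k) {x : complexBetti A.X 1 →ₗ[ℂ] complexBetti A.X 1}
    (hx : ∀ u ∈ weilSpecialUnitaryGroupCM A η (R.comp (X ^ 2)) h, ∀ v, x (u v) = u (x v)) :
    ∃ t s : Fin (cmDeg R) → ℂ,
      (∀ β i, x (wBasisCM hW β i : complexBetti A.X 1) = t β • (wBasisCM hW β i : complexBetti A.X 1)) ∧
      (∀ β j, x (wDualBasisCM hW hpol hRos β j : complexBetti A.X 1) =
        s β • (wDualBasisCM hW hpol hRos β j : complexBetti A.X 1)) := by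
  have hxT : ∀ (β : Fin (cmDeg R)) (p q : Fin (2 * k)), p ≠ q →
      ∀ v, x (torusCM hW hpol hRos β p q v) = torusCM hW hpol hRos β p q (x v) :=
    fun β p q hpq ↦ hx _ (torusCM_mem_weilSpecialUnitaryGroupCM hW hpol hRos β hpq)
  have hxS : ∀ (β : Fin (cmDeg R)) (p q : Fin (2 * k)), p ≠ q →
      ∀ v, x (swapCM hW hpol hRos β p q v) = swapCM hW hpol hRos β p q (x v) :=
    fun β p q hpq ↦ hx _ (swapCM_mem_weilSpecialUnitaryGroupCM hW hpol hRos β hpq)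
  set b := weilBasisι hW hpol hRos with hb
  have hk0 : 0 < 2 * k := by omega
  let i₀ : Fin (2 * k) := ⟨0, hk0⟩
  -- the diagonal entries are constant along each block and side
  have hconst : ∀ (β : Fin (cmDeg R)) (i : Fin (2 * k)) (σ : Fin 2),
      b.repr (x (b (β, i, σ))) (β, i, σ) = b.repr (x (b (β, i₀, σ))) (β, i₀, σ) := by
    intro β i σ
    by_cases hi : i = i₀
    · rw [hi]
    · exact repr_diag_eq_of_commute hW hpol hRos hk hxT hxS β (Ne.symm hi) σ
  refine ⟨fun β ↦ b.repr (x (b (β, i₀, 0))) (β, i₀, 0), fun β ↦ b.repr (x (b (β, i₀, 1))) (β, i₀, 1),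
    fun β i ↦ ?_, fun β j ↦ ?_⟩
  · rw [← weilBasisι_zero' hW hpol hRos, ← hb, apply_weilBasisι_eq_smul_of_commute hW hpol hRos hk hxT (β, i, 0),
      ← hb, hconst]
  · rw [← weilBasisι_one' hW hpol hRos, ← hb, apply_weilBasisι_eq_smul_of_commute hW hpol hRos hk hxT (β, j, 1),
      ← hb, hconst]

end Commutant

/-! ### §2 The commutant of `SU(φ)(ℂ)` is `ℂ[η^*]` -/

section PolynomialInEta

variable (hW : IsWeilTypeCM A η R e₀ k) (hpol : IsPolarizationClass A.dim A.X h) (hRos : IsRosatiCM A η h)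

include hW hpol hRos

omit hW hpol hRos in
/-- `τ_β ∈ Φ` (re-derived). [folklore] -/
private theorem cmEmb_mem' (β : Fin (cmDeg R)) : cmEmb R β ∈ cmType R := ((cmType R).equivFin.symm β).2

omit hW hpol hRos in
/-- `Im τ_β > 0` (re-derived). [cite: Deligne1982HodgeCycles, §4 p. 30] -/
private theorem cmEmb_im_pos' (β : Fin (cmDeg R)) : 0 < (cmEmb R β).im := by
  have hmem := cmEmb_mem' (R := R) β
  rw [cmType, Finset.mem_filter] at hmem
  exact hmem.2

omit hW hpol hRos in
/-- `τ_β` is a root of `P_R` (as a member of the root finset). [cite: Deligne1982HodgeCycles, §4 p. 30] -/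
private theorem cmEmb_mem_cmRoots' (β : Fin (cmDeg R)) : cmEmb R β ∈ cmRoots R := by
  have hmem := cmEmb_mem' (R := R) β
  rw [cmType, Finset.mem_filter] at hmem
  exact hmem.1

omit hpol hRos in
/-- `P_R(τ_β) = 0` (re-derived). [cite: Deligne1982HodgeCycles, §4 p. 30] -/
private theorem cmEmb_root' (β : Fin (cmDeg R)) :
    Polynomial.eval₂ (Int.castRingHom ℂ) (cmEmb R β) (R.comp (X ^ 2)) = 0 :=
  (mem_roots_toFinset_map_iff hW.monic_comp.ne_zero _).1 (cmEmb_mem_cmRoots' β)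

omit hpol hRos in
/-- `-τ_β` is a root of `P_R`. [cite: Deligne1982HodgeCycles, §4 p. 30] -/
private theorem neg_cmEmb_mem_cmRoots' (β : Fin (cmDeg R)) : -cmEmb R β ∈ cmRoots R :=
  (mem_roots_toFinset_map_iff hW.monic_comp.ne_zero _).2 (hW.neg_root (cmEmb_root' hW β))

omit hW hpol hRos in
/-- `-τ_β ∉ Φ` (`Im (-τ_β) < 0`). [cite: Deligne1982HodgeCycles, §4 p. 30] -/
private theorem neg_cmEmb_not_mem' (β : Fin (cmDeg R)) : -cmEmb R β ∉ cmType R := fun hmem ↦ by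
  rw [cmType, Finset.mem_filter, Complex.neg_im] at hmem
  have h2 := cmEmb_im_pos' (R := R) β
  linarith [hmem.2]

/-- **`End(H¹)^{SU(φ)(ℂ)} ⊆ ℂ[η^*]`** (`2k ≥ 4`): an operator commuting with `SU(φ)(ℂ)` is a polynomial in `η^*` — its
block scalars `t_β` (on `W_β = ker(η^* - τ_β)`) and `s_β` (on `W'_β = ker(η^* + τ_β)`) are interpolated at the `2e₀` simple
eigenvalues `±τ_β` of `η^*` (Lagrange), and a polynomial in `η^*` acts on an eigenvector by its value at the eigenvalue.
In print: `End_ℂ(V_ℂ)^{SU(φ)(ℂ)} = E ⊗ ℂ` («the same argument works in general»).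
[cite: vanGeemen1994HodgeAV, Lemma 6.10 and 6.9] [cite: Deligne1982HodgeCycles, §4 p. 32 and Milne 2003 re-edition endnote 16]
[cite: Milne2025AbelianMotivesCharP, §1.5 Example 1.17] -/
theorem exists_eq_aeval_pullbackOne_of_commute (hk : 2 ≤ k) {x : complexBetti A.X 1 →ₗ[ℂ] complexBetti A.X 1}
    (hx : ∀ u ∈ weilSpecialUnitaryGroupCM A η (R.comp (X ^ 2)) h, ∀ v, x (u v) = u (x v)) :
    ∃ Q : ℂ[X], x = aeval (pullbackOne A η) Q := by
  classical
  obtain ⟨t, s, ht, hs⟩ := exists_apply_wBasisCM_eq_smul_of_commute hW hpol hRos hk hx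
  -- the block scalar as a function of the eigenvalue `±τ_β`
  let f : ℂ → ℂ := fun μ ↦ if hμ : μ ∈ cmType R then t ((cmType R).equivFin ⟨μ, hμ⟩)
    else if hμ' : -μ ∈ cmType R then s ((cmType R).equivFin ⟨-μ, hμ'⟩) else 0
  have hft : ∀ β, f (cmEmb R β) = t β := fun β ↦ by
    simp only [f, dif_pos (cmEmb_mem' β)]
    rw [show (⟨cmEmb R β, cmEmb_mem' β⟩ : ↥(cmType R)) = (cmType R).equivFin.symm β from Subtype.ext rfl,
      Equiv.apply_symm_apply]
  have hfs : ∀ β, f (-cmEmb R β) = s β := fun β ↦ by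
    have h2 : -(-cmEmb R β) ∈ cmType R := by rw [neg_neg]; exact cmEmb_mem' β
    simp only [f, dif_neg (neg_cmEmb_not_mem' β), dif_pos h2]
    rw [show (⟨-(-cmEmb R β), h2⟩ : ↥(cmType R)) = (cmType R).equivFin.symm β from Subtype.ext (neg_neg _),
      Equiv.apply_symm_apply]
  refine ⟨Lagrange.interpolate (cmRoots R) id f, ?_⟩
  -- a polynomial in `η^*` acts on an eigenvector of a root `μ` by `f μ`
  have hnode : ∀ {μ : ℂ}, μ ∈ cmRoots R → ∀ {w : complexBetti A.X 1}, w ∈ eig A η μ → w ≠ 0 →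
      aeval (pullbackOne A η) (Lagrange.interpolate (cmRoots R) id f) w = f μ • w := by
    intro μ hμ w hw hw0
    rw [Module.End.aeval_apply_of_hasEigenvector ⟨hw, hw0⟩]
    congr 1
    exact Lagrange.eval_interpolate_at_node f (Set.injOn_id _) hμ
  refine (weilBasisι hW hpol hRos).ext fun r ↦ ?_
  obtain ⟨β, i, σ⟩ := r
  obtain rfl | rfl : σ = 0 ∨ σ = 1 := by fin_cases σ <;> simp
  · have hne := (weilBasisι hW hpol hRos).ne_zero (β, i, 0)
    rw [weilBasisι_zero'] at hne ⊢
    rw [ht, hnode (cmEmb_mem_cmRoots' β) (wBasisCM hW β i).2 hne, hft]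
  · have hne := (weilBasisι hW hpol hRos).ne_zero (β, i, 1)
    rw [weilBasisι_one'] at hne ⊢
    rw [hs, hnode (neg_cmEmb_mem_cmRoots' hW β) (wDualBasisCM hW hpol hRos β i).2 hne, hfs]

omit hpol hRos in
/-- **Every polynomial in `η^*` is a combination of `1, η^*, …, (η^*)^{2e₀-1}`** (reduce modulo the monic `P_R` of degree
`2e₀`, which kills `η^*`). [cite: Deligne1982HodgeCycles, §4 p. 32 (`ν : E = ℚ[T]/(P_R) → End⁰(A)`)] -/
theorem IsWeilTypeCM.aeval_pullbackOne_mem_span_pow (Q : ℂ[X]) :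
    aeval (pullbackOne A η) Q ∈ Submodule.span ℂ (Set.range fun j : Fin (2 * e₀) ↦ pullbackOne A η ^ (j : ℕ)) := by
  set P := (R.comp (X ^ 2)).map (Int.castRingHom ℂ) with hP
  have hPm : P.Monic := hW.monic_comp.map _
  have hP0 : aeval (pullbackOne A η) P = 0 := aeval_hom_complexBetti_map_one_eq_zero hW.eval₂_eq_zero
  have hPdeg : P.natDegree = 2 * e₀ := by rw [hP, hW.monic_comp.natDegree_map, hW.natDegree_comp]
  have hP1 : P ≠ 1 := fun h1 ↦ by
    have := hW.e₀_pos
    rw [h1, natDegree_one] at hPdeg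
    omega
  rw [← aeval_modByMonic_eq_self_of_root (p := Q) hP0,
    aeval_eq_sum_range' (lt_of_lt_of_eq (natDegree_modByMonic_lt Q hPm hP1) hPdeg)]
  exact Submodule.sum_mem _ fun i hi ↦
    Submodule.smul_mem _ _ (Submodule.subset_span ⟨⟨i, Finset.mem_range.1 hi⟩, rfl⟩)

/-- **`End(H¹)^{SU(φ)(ℂ)} ⊆ ⟨1, η^*, …, (η^*)^{2e₀-1}⟩_ℂ`** (a `2e₀ = [E : ℚ]`-dimensional space).
[cite: vanGeemen1994HodgeAV, Lemma 6.10] [cite: Milne2025AbelianMotivesCharP, §1.5 Example 1.17] -/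
theorem mem_span_pow_pullbackOne_of_commute (hk : 2 ≤ k) {x : complexBetti A.X 1 →ₗ[ℂ] complexBetti A.X 1}
    (hx : ∀ u ∈ weilSpecialUnitaryGroupCM A η (R.comp (X ^ 2)) h, ∀ v, x (u v) = u (x v)) :
    x ∈ Submodule.span ℂ (Set.range fun j : Fin (2 * e₀) ↦ pullbackOne A η ^ (j : ℕ)) := by
  obtain ⟨Q, rfl⟩ := exists_eq_aeval_pullbackOne_of_commute hW hpol hRos hk hx
  exact hW.aeval_pullbackOne_mem_span_pow Q

/-- **For the general member, every endomorphism is a polynomial in `η` on `H¹`**: `ψ^* = Q(η^*)` — `ψ^*` commutes with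
`Hg(A)(ℂ)|_{H¹}` (the graph of `ψ` is a Hodge class, tree `pullbackOne_commute_hodgeGroup`), which is `SU(φ)(ℂ)`.
[cite: vanGeemen1994HodgeAV, 6.4–6.5 and Lemma 6.10] [cite: Deligne1982HodgeCycles, I Prop. 3.4 and Milne 2003 re-edition endnote 16]
[cite: Milne2025AbelianMotivesCharP, §1.5 Example 1.17] -/
theorem exists_pullbackOne_eq_aeval_of_hasHodgeGroupSUCM (hSU : HasHodgeGroupSUCM A η (R.comp (X ^ 2)) h) (hk : 2 ≤ k)
    (ψ : A ⟶ A) : ∃ Q : ℂ[X], pullbackOne A ψ = aeval (pullbackOne A η) Q :=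
  exists_eq_aeval_pullbackOne_of_commute hW hpol hRos hk fun u hu v ↦ by
    have hu' : u ∈ hodgeGroupOne A.dim A.X := by rw [hasHodgeGroupSUCM_iff.1 hSU]; exact hu
    obtain ⟨g, hg, rfl⟩ := mem_hodgeGroupOne_iff.1 hu'
    exact HodgeGroupSemisimple.pullbackOne_commute_hodgeGroup ψ g hg v

/-- `ψ^* ∈ ⟨1, η^*, …, (η^*)^{2e₀-1}⟩_ℂ` for every `ψ ∈ End(A)` («`End⁰(A) ⊗ ℂ ⊆ E ⊗ ℂ`»).
[cite: Milne2025AbelianMotivesCharP, §1.5 Example 1.17] [cite: vanGeemen1994HodgeAV, Lemma 6.10 and Thm. 6.11] -/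
theorem pullbackOne_mem_span_pow_of_hasHodgeGroupSUCM (hSU : HasHodgeGroupSUCM A η (R.comp (X ^ 2)) h) (hk : 2 ≤ k)
    (ψ : A ⟶ A) : pullbackOne A ψ ∈ Submodule.span ℂ (Set.range fun j : Fin (2 * e₀) ↦ pullbackOne A η ^ (j : ℕ)) := by
  obtain ⟨Q, hQ⟩ := exists_pullbackOne_eq_aeval_of_hasHodgeGroupSUCM hW hpol hRos hSU hk ψ
  rw [hQ]
  exact hW.aeval_pullbackOne_mem_span_pow Q

/-- **`End(A)` is commutative** for the general member (all `ψ^*` are polynomials in `η^*`; the complex representation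
is faithful, tree `hom_eq_zero_of_complexBetti_map_one_eq_zero`). [cite: Milne2025AbelianMotivesCharP, §1.5 Example 1.17]
[cite: LangeBirkenhake1992, §1.2 Prop. 1.2.3] -/
theorem comp_comm_of_hasHodgeGroupSUCM (hSU : HasHodgeGroupSUCM A η (R.comp (X ^ 2)) h) (hk : 2 ≤ k)
    (φ' ψ : A ⟶ A) : φ' ≫ ψ = ψ ≫ φ' := by
  obtain ⟨P, hP⟩ := exists_pullbackOne_eq_aeval_of_hasHodgeGroupSUCM hW hpol hRos hSU hk φ'
  obtain ⟨Q, hQ⟩ := exists_pullbackOne_eq_aeval_of_hasHodgeGroupSUCM hW hpol hRos hSU hk ψ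
  have hc : pullbackOne A (φ' ≫ ψ) = pullbackOne A (ψ ≫ φ') := by
    rw [pullbackOne_comp_eq_mul, pullbackOne_comp_eq_mul, hP, hQ, ← map_mul, ← map_mul, mul_comm]
  have h0 : pullbackOne A (φ' ≫ ψ - ψ ≫ φ') = 0 := by rw [pullbackOne_sub_eq_sub, hc, sub_self]
  exact sub_eq_zero.1 (hom_eq_zero_of_complexBetti_map_one_eq_zero _ h0)

/-- `η` is central in `End(A)`. [cite: Milne2025AbelianMotivesCharP, §1.5 Example 1.17] -/
theorem comp_eta_comm_of_hasHodgeGroupSUCM (hSU : HasHodgeGroupSUCM A η (R.comp (X ^ 2)) h) (hk : 2 ≤ k)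
    (ψ : A ⟶ A) : ψ ≫ η = η ≫ ψ :=
  comp_comm_of_hasHodgeGroupSUCM hW hpol hRos hSU hk ψ η

end PolynomialInEta

/-! ### §3 `[End⁰(A) : ℚ] = 2e₀ = [E : ℚ]` and `End⁰(A) = ℚ[η]` -/

section EndAlgebra

variable (hW : IsWeilTypeCM A η R e₀ k) (hpol : IsPolarizationClass A.dim A.X h) (hRos : IsRosatiCM A η h)

include hW hpol hRos

/-- **`[End⁰(A) : ℚ] ≤ 2e₀`**: a `ℚ`-basis of `End⁰(A)` goes, under the injective rational representation (tree
`bettiRep_injective`), to `ℚ`-independent operators whose complexifications are `ℂ`-independent (tree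
`linearIndependent_baseChange_of_linearIndependent_end`) and lie in the conjugate, along
`H¹(A(ℂ); ℚ) ⊗ ℂ ≅ H¹(A(ℂ); ℂ)`, of the `2e₀`-dimensional space `⟨1, η^*, …, (η^*)^{2e₀-1}⟩_ℂ` (§2).
[cite: Milne2025AbelianMotivesCharP, §1.5 Example 1.17] [cite: LangeBirkenhake1992, §1.2 Prop. 1.2.3] -/
theorem finrank_endAlgebra_le_of_hasHodgeGroupSUCM (hSU : HasHodgeGroupSUCM A η (R.comp (X ^ 2)) h) (hk : 2 ≤ k) :
    Module.finrank ℚ A.endAlgebra ≤ 2 * e₀ := by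
  classical
  haveI : Module.Finite ℚ (bettiCohomology A.X 1) := finite_bettiCohomology_one A
  haveI : Module.Finite ℂ (complexBetti A.X 1) := finite_complexBetti_abelianVariety A 1
  set bE := Module.finBasis ℚ A.endAlgebra with hbE
  -- the rational representation as a `ℚ`-linear map into `End_ℚ H¹(A(ℂ); ℚ)`
  set ρ : A.endAlgebra →ₗ[ℚ] Module.End ℚ (bettiCohomology A.X 1) :=
    (MulOpposite.opLinearEquiv ℚ (M := Module.End ℚ (bettiCohomology A.X 1))).symm.toLinearMap ∘ₗ
      (bettiRep A).toLinearMap with hρ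
  have hρapply : ∀ x, ρ x = MulOpposite.unop (bettiRep A x) := fun x => rfl
  have hρinj : Function.Injective ρ := fun x y hxy =>
    bettiRep_injective (A := A) (MulOpposite.unop_injective (by rwa [hρapply, hρapply] at hxy))
  have hli : LinearIndependent ℚ (ρ ∘ bE) := bE.linearIndependent.map_injOn ρ hρinj.injOn
  have hliC := linearIndependent_baseChange_of_linearIndependent_end (u := ρ ∘ bE) hli
  -- the target space: the conjugate of `⟨(η^*)^j⟩_{j < 2e₀}` under the comparison `β`
  set β := ofRatClassBaseChangeEquiv (Motives.AbelianVariety.isSmoothProjective_holds (A := A)) 1 with hβ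
  set S₀ : Submodule ℂ (Module.End ℂ (complexBetti A.X 1)) :=
    Submodule.span ℂ (Set.range fun j : Fin (2 * e₀) ↦ pullbackOne A η ^ (j : ℕ)) with hS₀
  set S : Submodule ℂ (Module.End ℂ (ℂ ⊗[ℚ] bettiCohomology A.X 1)) :=
    S₀.map ((β.symm.conj : Module.End ℂ (complexBetti A.X 1) ≃ₗ[ℂ] Module.End ℂ (ℂ ⊗[ℚ] bettiCohomology A.X 1)) :
      Module.End ℂ (complexBetti A.X 1) →ₗ[ℂ] Module.End ℂ (ℂ ⊗[ℚ] bettiCohomology A.X 1)) with hS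
  have hconj : ∀ ψ : A ⟶ A, (bettiCohomology.map ψ.hom.hom.hom 1).hom.baseChange ℂ = β.symm.conj (pullbackOne A ψ) :=
    fun ψ ↦ by
      rw [LinearEquiv.conj_apply, LinearEquiv.symm_symm, LinearMap.comp_assoc]
      exact baseChange_bettiMap_eq_conj ψ
  have hmem : ∀ j, ((ρ ∘ bE) j).baseChange ℂ ∈ S := fun j => by
    rw [Function.comp_apply, hρapply]
    obtain ⟨M, F, -, hF⟩ := AbelianVariety.endAlgebra.exists_eq_algebraMap_mul_of (bE j)
    rw [hF, map_mul, AlgHom.commutes, bettiRep_of, MulOpposite.algebraMap_apply, ← MulOpposite.op_mul,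
      MulOpposite.unop_op, ← Algebra.commutes, ← Algebra.smul_def, LinearMap.baseChange_smul, hconj]
    exact Submodule.smul_of_tower_mem _ _
      ⟨pullbackOne A F, pullbackOne_mem_span_pow_of_hasHodgeGroupSUCM hW hpol hRos hSU hk F, rfl⟩
  have hspan : Submodule.span ℂ (Set.range fun j => ((ρ ∘ bE) j).baseChange ℂ) ≤ S :=
    Submodule.span_le.2 (by rintro _ ⟨j, rfl⟩; exact hmem j)
  have hS2 : Module.finrank ℂ S ≤ 2 * e₀ := by
    refine (Submodule.finrank_map_le _ _).trans ?_
    exact (finrank_range_le_card _).trans (Fintype.card_fin _).le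
  calc Module.finrank ℚ A.endAlgebra = Fintype.card (Fin (Module.finrank ℚ A.endAlgebra)) := (Fintype.card_fin _).symm
    _ = Module.finrank ℂ (Submodule.span ℂ (Set.range fun j => ((ρ ∘ bE) j).baseChange ℂ)) :=
        (finrank_span_eq_card hliC).symm
    _ ≤ Module.finrank ℂ S := Submodule.finrank_mono hspan
    _ ≤ 2 * e₀ := hS2

omit hpol hRos in
/-- `P_R(1 ⊗ η) = 0` in `End⁰(A)` (`End(A) → End⁰(A)` is a ring map). [cite: Deligne1982HodgeCycles, §4 p. 32] -/
theorem IsWeilTypeCM.aeval_endAlgebra_of_eq_zero :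
    aeval (AbelianVariety.endAlgebra.of A η) ((R.comp (X ^ 2)).map (Int.castRingHom ℚ)) = 0 := by
  rw [aeval_def, eval₂_map, RingHom.ext_int ((algebraMap ℚ A.endAlgebra).comp (Int.castRingHom ℚ))
    ((AbelianVariety.endAlgebra.of A).comp (Int.castRingHom (End A))), ← hom_eval₂, hW.eval₂_eq_zero, map_zero]

omit hpol hRos in
/-- **`minpoly_ℚ(1 ⊗ η) = P_R`** in `End⁰(A)` (`P_R` irreducible monic with `P_R(η) = 0`; `End⁰(A) ≠ 0`).
[cite: Deligne1982HodgeCycles, §4 p. 30 and p. 32] -/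
theorem IsWeilTypeCM.minpoly_endAlgebra_of :
    minpoly ℚ (AbelianVariety.endAlgebra.of A η) = (R.comp (X ^ 2)).map (Int.castRingHom ℚ) := by
  haveI := nontrivial_endAlgebra_of_dim_pos (B := A) (by have := hW.two_le_dim; omega)
  exact (minpoly.eq_of_irreducible_of_monic hW.irreducible hW.aeval_endAlgebra_of_eq_zero (hW.monic_comp.map _)).symm

omit hpol hRos in
/-- **`1, η, …, η^{2e₀-1}` are `ℚ`-independent in `End⁰(A)`** (`deg minpoly_ℚ(η) = 2e₀`).
[cite: Deligne1982HodgeCycles, §4 p. 30 (`[E : ℚ] = 2e₀`)] -/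
theorem IsWeilTypeCM.linearIndependent_pow_endAlgebra_of :
    LinearIndependent ℚ fun j : Fin (2 * e₀) ↦ AbelianVariety.endAlgebra.of A η ^ (j : ℕ) := by
  have h := linearIndependent_pow (K := ℚ) (AbelianVariety.endAlgebra.of A η)
  have hdeg : (minpoly ℚ (AbelianVariety.endAlgebra.of A η)).natDegree = 2 * e₀ := by
    rw [hW.minpoly_endAlgebra_of, hW.monic_comp.natDegree_map, hW.natDegree_comp]
  have h' := h.comp (Fin.cast hdeg.symm) (Fin.cast_injective _)
  simpa only [Function.comp_def, Fin.val_cast] using h'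

/-- **`[End⁰(A) : ℚ] = 2e₀ = [E : ℚ]`** for the general member of a CM-Weil family (`2k ≥ 4`).
[cite: Milne2025AbelianMotivesCharP, §1.5 Example 1.17] [cite: MoonenZarhin1999LowDim, §1 (type IV, `e = 2e₀`)] -/
theorem finrank_endAlgebra_eq_of_hasHodgeGroupSUCM (hSU : HasHodgeGroupSUCM A η (R.comp (X ^ 2)) h) (hk : 2 ≤ k) :
    Module.finrank ℚ A.endAlgebra = 2 * e₀ := by
  refine le_antisymm (finrank_endAlgebra_le_of_hasHodgeGroupSUCM hW hpol hRos hSU hk) ?_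
  have h := hW.linearIndependent_pow_endAlgebra_of.fintype_card_le_finrank
  simpa using h

/-- **`End⁰(A) = ℚ[η]`**: every element of `End⁰(A)` is a rational polynomial in `1 ⊗ η` (the `2e₀` independent powers
span the `2e₀`-dimensional `End⁰(A)`). [cite: Milne2025AbelianMotivesCharP, §1.5 Example 1.17] -/
theorem exists_eq_aeval_endAlgebra_of_hasHodgeGroupSUCM (hSU : HasHodgeGroupSUCM A η (R.comp (X ^ 2)) h) (hk : 2 ≤ k)
    (x : A.endAlgebra) : ∃ q : ℚ[X], x = aeval (AbelianVariety.endAlgebra.of A η) q := by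
  have hli := hW.linearIndependent_pow_endAlgebra_of
  have hfin := finrank_endAlgebra_eq_of_hasHodgeGroupSUCM hW hpol hRos hSU hk
  -- (the two `AddCommMonoid` structures on the type synonym `End⁰(A)` are not bridged by instance search, cf.
  -- `AbelianVarietyEndAlgebraInstances`; the vector-space lemma is fed its instances explicitly)
  have htop : Submodule.span ℚ (Set.range fun j : Fin (2 * e₀) ↦ AbelianVariety.endAlgebra.of A η ^ (j : ℕ)) = ⊤ :=
    @LinearIndependent.span_eq_top_of_card_eq_finrank' ℚ A.endAlgebra _ Ring.toAddCommGroup Algebra.toModule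
      (Fin (2 * e₀)) _ (AbelianVariety.endAlgebra.instModuleFinite A) _ hli ((Fintype.card_fin _).trans hfin.symm)
  have hx := Submodule.eq_top_iff'.1 htop x
  obtain ⟨c, hc⟩ := (Submodule.mem_span_range_iff_exists_fun ℚ).1 hx
  refine ⟨∑ j : Fin (2 * e₀), Polynomial.monomial (j : ℕ) (c j), ?_⟩
  rw [map_sum, ← hc]
  refine Finset.sum_congr rfl fun j _ ↦ ?_
  rw [aeval_monomial, Algebra.smul_def]

/-- **`End⁰(A)` is commutative.** [cite: Milne2025AbelianMotivesCharP, §1.5 Example 1.17] -/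
theorem endAlgebra_mul_comm_of_hasHodgeGroupSUCM (hSU : HasHodgeGroupSUCM A η (R.comp (X ^ 2)) h) (hk : 2 ≤ k)
    (x y : A.endAlgebra) : x * y = y * x := by
  obtain ⟨p, rfl⟩ := exists_eq_aeval_endAlgebra_of_hasHodgeGroupSUCM hW hpol hRos hSU hk x
  obtain ⟨q, rfl⟩ := exists_eq_aeval_endAlgebra_of_hasHodgeGroupSUCM hW hpol hRos hSU hk y
  rw [← map_mul, ← map_mul, mul_comm]

end EndAlgebra

/-! ### §4 `End⁰(A) = ℚ(η)` is a field: `A` simple, of type IV, not of CM type -/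

section Field

variable (hW : IsWeilTypeCM A η R e₀ k) (hpol : IsPolarizationClass A.dim A.X h) (hRos : IsRosatiCM A η h)

include hW hpol hRos

/-- **`End⁰(A) = ℚ(η) ≅ E` IS A FIELD**: `End⁰(A) = ℚ[η]` with `P_R` irreducible and `P_R(η) = 0`, so a non-zero
`x = q(η)` has `P_R ∤ q`, `a P_R + b q = 1` (Bezout), and `b(η)` inverts `x`.
[cite: Milne2025AbelianMotivesCharP, §1.5 Example 1.17 (`L(A) = GU(φ)`, i.e. `End⁰(A) = Q`)]
[cite: Deligne1982HodgeCycles, §4 p. 30 and Milne 2003 re-edition endnote 16] -/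
theorem isField_endAlgebra_of_hasHodgeGroupSUCM (hSU : HasHodgeGroupSUCM A η (R.comp (X ^ 2)) h) (hk : 2 ≤ k) :
    IsField A.endAlgebra := by
  haveI := nontrivial_endAlgebra_of_dim_pos (B := A) (by have := hW.two_le_dim; omega)
  refine ⟨exists_pair_ne _, endAlgebra_mul_comm_of_hasHodgeGroupSUCM hW hpol hRos hSU hk, fun {x} hx ↦ ?_⟩
  obtain ⟨q, rfl⟩ := exists_eq_aeval_endAlgebra_of_hasHodgeGroupSUCM hW hpol hRos hSU hk x
  have hP0 := hW.aeval_endAlgebra_of_eq_zero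
  have hndvd : ¬ (R.comp (X ^ 2)).map (Int.castRingHom ℚ) ∣ q := fun hdvd ↦
    hx (aeval_eq_zero_of_dvd_aeval_eq_zero hdvd hP0)
  obtain ⟨a, b, hab⟩ := hW.irreducible.coprime_iff_not_dvd.2 hndvd
  refine ⟨aeval (AbelianVariety.endAlgebra.of A η) b, ?_⟩
  have e := congrArg (aeval (AbelianVariety.endAlgebra.of A η)) hab
  rw [map_add, map_mul, map_mul, hP0, mul_zero, zero_add, map_one] at e
  exact (endAlgebra_mul_comm_of_hasHodgeGroupSUCM hW hpol hRos hSU hk _ _).trans e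

/-- **THE GENERAL MEMBER OF A CM-WEIL FAMILY IS SIMPLE** (`End⁰(A)` a field; tree `isSimple_of_isField_endAlgebra`).
[cite: Milne2025AbelianMotivesCharP, §1.5 Example 1.17] [cite: MumfordAV1970, §19 Cor. 2 of Thm. 1] -/
theorem isSimple_of_hasHodgeGroupSUCM (hSU : HasHodgeGroupSUCM A η (R.comp (X ^ 2)) h) (hk : 2 ≤ k) :
    AbelianVariety.IsSimple A :=
  AbelianVariety.isSimple_of_isField_endAlgebra (isField_endAlgebra_of_hasHodgeGroupSUCM hW hpol hRos hSU hk)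

omit hpol hRos in
/-- `η^*` has the eigenvalue `τ_β` on `H¹(A(ℂ); ℂ)` (`dim W_β = 2k > 0`). [cite: Deligne1982HodgeCycles, §4 p. 32] -/
theorem IsWeilTypeCM.hasEigenvalue_pullbackOne_cmEmb (β : Fin (cmDeg R)) :
    (pullbackOne A η).HasEigenvalue (cmEmb R β) := by
  rw [Module.End.hasEigenvalue_iff]
  intro hbot
  have h := hW.finrank_eig (cmEmb_root' hW β)
  have h0 : Module.finrank ℂ (eig A η (cmEmb R β)) = 0 := by
    rw [show eig A η (cmEmb R β) = ⊥ from hbot, finrank_bot]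
  have := hW.k_pos
  omega

omit hpol hRos in
/-- The CM type `Φ` is non-empty: `0 < cmDeg R` (`P_R` has a complex root; it or its negative lies in `Φ`).
[cite: Deligne1982HodgeCycles, §4 p. 30] -/
theorem IsWeilTypeCM.cmDeg_pos : 0 < cmDeg R := by
  classical
  set P := (R.comp (X ^ 2)).map (Int.castRingHom ℂ) with hP
  have hPdeg : P.natDegree = 2 * e₀ := by rw [hP, hW.monic_comp.natDegree_map, hW.natDegree_comp]
  have hdeg : 0 < P.degree := by
    rw [← natDegree_pos_iff_degree_pos, hPdeg]
    have := hW.e₀_pos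
    omega
  obtain ⟨z, hz⟩ := Complex.exists_root hdeg
  have hz' : Polynomial.eval₂ (Int.castRingHom ℂ) z (R.comp (X ^ 2)) = 0 := by
    rw [Polynomial.IsRoot.def, hP, Polynomial.eval_map] at hz
    exact hz
  rcases hW.mem_cmType_or_neg_mem hz' with hmem | hmem
  · exact Finset.card_pos.2 ⟨_, hmem⟩
  · exact Finset.card_pos.2 ⟨_, hmem⟩

/-- **THE GENERAL MEMBER OF A CM-WEIL FAMILY HAS A FACTOR OF TYPE IV**: the tree's `HasNoTypeIVFactor A` fails — the
CENTRAL endomorphism `η` has the non-real eigenvalue `τ_β` on `H¹(A(ℂ); ℂ)`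
(tree `hasNoTypeIVFactor_iff_forall_comp_comm_hasEigenvalue_im_eq_zero`). In Albert's classification: type IV with centre
the CM field `E`. [cite: MoonenZarhin1999LowDim, §1 (type 4: `F` is a CM-field)] [cite: Milne2025AbelianMotivesCharP, §1.5 Example 1.17] -/
theorem not_hasNoTypeIVFactor_of_hasHodgeGroupSUCM (hSU : HasHodgeGroupSUCM A η (R.comp (X ^ 2)) h) (hk : 2 ≤ k) :
    ¬ HasNoTypeIVFactor A := fun h4 ↦ by
  set β : Fin (cmDeg R) := ⟨0, hW.cmDeg_pos⟩
  have him := (hasNoTypeIVFactor_iff_forall_comp_comm_hasEigenvalue_im_eq_zero.1 h4) η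
    (fun φ' ↦ comp_eta_comm_of_hasHodgeGroupSUCM hW hpol hRos hSU hk φ') _ (hW.hasEigenvalue_pullbackOne_cmEmb β)
  exact (cmEmb_im_pos' (R := R) β).ne' him

/-- **`End⁰(A)` IS A CM FIELD** (a field with a factor of type IV, Shimura §5.1 Prop. 5 via the tree's
`not_hasNoTypeIVFactor_iff_isCMField_endField`). [cite: MoonenZarhin1999LowDim, §1 (Type 4(e₀, d))]
[cite: Shimura1998, §5.1 Proposition 5 (p. 36)] [cite: Milne2025AbelianMotivesCharP, §1.5 Example 1.17] -/
theorem isCMField_endField_of_hasHodgeGroupSUCM (hSU : HasHodgeGroupSUCM A η (R.comp (X ^ 2)) h) (hk : 2 ≤ k) :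
    NumberField.IsCMField (EndField A (isField_endAlgebra_of_hasHodgeGroupSUCM hW hpol hRos hSU hk)) :=
  (not_hasNoTypeIVFactor_iff_isCMField_endField _).1 (not_hasNoTypeIVFactor_of_hasHodgeGroupSUCM hW hpol hRos hSU hk)

/-- **THE GENERAL MEMBER OF A CM-WEIL FAMILY IS NOT OF CM TYPE**: a simple abelian variety of CM type has
`[End⁰ : ℚ] = 2 dim A` (tree `isOfCMType_iff_isOfCMTypeSimple`), but here `[End⁰(A) : ℚ] = 2e₀ < 2 dim A = 4ke₀`.
[cite: Milne1999, §2 p. 54] [cite: Milne2025AbelianMotivesCharP, §1.5 Example 1.17] -/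
theorem not_isOfCMType_of_hasHodgeGroupSUCM (hSU : HasHodgeGroupSUCM A η (R.comp (X ^ 2)) h) (hk : 2 ≤ k) :
    ¬ Milne1999.IsOfCMType A := fun hCM ↦ by
  have hq := ((Milne1999.isOfCMType_iff_isOfCMTypeSimple (isSimple_of_hasHodgeGroupSUCM hW hpol hRos hSU hk)
    (by have := hW.two_le_dim; omega)).1 hCM).2
  rw [finrank_endAlgebra_eq_of_hasHodgeGroupSUCM hW hpol hRos hSU hk, hW.dim_eq] at hq
  have := hW.e₀_pos
  have := hW.k_pos
  nlinarith

/-- **SUMMARY — THE GENERAL MEMBER OF A CM-WEIL FAMILY (`Hg = SU(φ)`, `2k ≥ 4`)**: `A` is SIMPLE, `End⁰(A)` is a FIELD of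
degree `2e₀ = [E : ℚ]` which is CM (so `A` is of Albert type IV and has a factor of type IV), `A` is NOT of CM type, and its
Hodge group is SEMISIMPLE (tree `hasSemisimpleHodgeGroup_of_hasHodgeGroupSUCM`).
[cite: Milne2025AbelianMotivesCharP, §1.5 Example 1.17] [cite: Deligne1982HodgeCycles, §4 (4.4) and Milne 2003 re-edition endnote 16]
[cite: MoonenZarhin1999LowDim, §1] -/
theorem weilTypeCM_generalMember_summary (hSU : HasHodgeGroupSUCM A η (R.comp (X ^ 2)) h) (hk : 2 ≤ k) :
    AbelianVariety.IsSimple A ∧ IsField A.endAlgebra ∧ Module.finrank ℚ A.endAlgebra = 2 * e₀ ∧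
      ¬ Milne1999.IsOfCMType A ∧ HasSemisimpleHodgeGroup A ∧ ¬ HasNoTypeIVFactor A :=
  ⟨isSimple_of_hasHodgeGroupSUCM hW hpol hRos hSU hk, isField_endAlgebra_of_hasHodgeGroupSUCM hW hpol hRos hSU hk,
    finrank_endAlgebra_eq_of_hasHodgeGroupSUCM hW hpol hRos hSU hk, not_isOfCMType_of_hasHodgeGroupSUCM hW hpol hRos hSU hk,
    hasSemisimpleHodgeGroup_of_hasHodgeGroupSUCM hW hpol hRos hSU, not_hasNoTypeIVFactor_of_hasHodgeGroupSUCM hW hpol hRos hSU hk⟩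

end Field

end Literature.AlgebraicGeometry.Deligne1982

end
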